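import Mathlib
import Literature.MathematicalPhysics.QuantumLattice.GrassmannIntegralProofs
import HarnessLib

/-!
# Zero-mode action floor — pointwise Clifford algebra of the curvature term (lead c7, line
`zero-mode-floor-dilute-gas` of crux `NestedDissectionSea.EarlyCrosserLaw`, stmt-QuantumFields-13995)

Helpers for the registered stub `stub_floorAssembly`: the six products `γ_μγ_ν` (`μ < ν`) of the tree's
chiral-basis gamma matrices written out, the chirality-block form of the Clifford-contracted curvature
`𝔉v := Σ_{μ<ν} (γ_μγ_ν) ⊗ F_μν v` (upper block sees only the combinations `F₀₁−F₂₃, F₀₂+F₁₃, F₀₃−F₁₂`,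
lower block only `F₀₁+F₂₃, F₀₂−F₁₃, F₀₃+F₁₂`), and the pointwise bound
`Re⟨v, 𝔉v⟩ ≤ √3·√(Σ‖F⁻‖²)·|v₊|² + √3·√(Σ‖F⁺‖²)·|v₋|²` (Frobenius norms), plus the duality identities
`Σ‖F⁻‖² + Σ‖F⁺‖² = 2Σ_{μ<ν}‖F_μν‖²` and, for anti-Hermitian `F_μν`,
`Σ‖F⁺‖² − Σ‖F⁻‖² = −4 Re tr(F₀₁F₂₃ − F₀₂F₁₃ + F₀₃F₁₂)`.
-/

noncomputable section

open scoped BigOperators Matrix Matrix.Norms.Frobenius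
open Complex Literature.MathematicalPhysics.QuantumLattice

namespace Summit.QuantumFields.QCD.Cruxes.EarlyCrosserLaw.ZeroModeFloorDiluteGas

/-! ## The six products `γ_μ γ_ν`, `μ < ν` -/

/-- `γ₀γ₁ = diag(i, −i, i, −i)` for the tree's chiral-basis gamma matrices. -/
theorem euclideanGamma_zero_mul_one :
    euclideanGamma 0 * euclideanGamma 1 = !![I, 0, 0, 0; 0, -I, 0, 0; 0, 0, I, 0; 0, 0, 0, -I] := by
  rw [euclideanGamma_zero, euclideanGamma_one]
  ext i j
  fin_cases i <;> fin_cases j <;> simp [Matrix.mul_apply, Fin.sum_univ_four]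

/-- `γ₀γ₂` written out. -/
theorem euclideanGamma_zero_mul_two :
    euclideanGamma 0 * euclideanGamma 2 = !![0, -1, 0, 0; 1, 0, 0, 0; 0, 0, 0, -1; 0, 0, 1, 0] := by
  rw [euclideanGamma_zero, euclideanGamma_two]
  ext i j
  fin_cases i <;> fin_cases j <;> simp [Matrix.mul_apply, Fin.sum_univ_four]

/-- `γ₀γ₃` written out. -/
theorem euclideanGamma_zero_mul_three :
    euclideanGamma 0 * euclideanGamma 3 = !![0, -I, 0, 0; -I, 0, 0, 0; 0, 0, 0, I; 0, 0, I, 0] := by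
  rw [euclideanGamma_zero, euclideanGamma_three]
  ext i j
  fin_cases i <;> fin_cases j <;> simp [Matrix.mul_apply, Fin.sum_univ_four]

/-- `γ₁γ₂` written out. -/
theorem euclideanGamma_one_mul_two :
    euclideanGamma 1 * euclideanGamma 2 = !![0, I, 0, 0; I, 0, 0, 0; 0, 0, 0, I; 0, 0, I, 0] := by
  rw [euclideanGamma_one, euclideanGamma_two]
  ext i j
  fin_cases i <;> fin_cases j <;> simp [Matrix.mul_apply, Fin.sum_univ_four]

/-- `γ₁γ₃` written out. -/
theorem euclideanGamma_one_mul_three :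
    euclideanGamma 1 * euclideanGamma 3 = !![0, -1, 0, 0; 1, 0, 0, 0; 0, 0, 0, 1; 0, 0, -1, 0] := by
  rw [euclideanGamma_one, euclideanGamma_three]
  ext i j
  fin_cases i <;> fin_cases j <;> simp [Matrix.mul_apply, Fin.sum_univ_four]

/-- `γ₂γ₃` written out. -/
theorem euclideanGamma_two_mul_three :
    euclideanGamma 2 * euclideanGamma 3 = !![-I, 0, 0, 0; 0, I, 0, 0; 0, 0, I, 0; 0, 0, 0, -I] := by
  rw [euclideanGamma_two, euclideanGamma_three]
  ext i j
  fin_cases i <;> fin_cases j <;> simp [Matrix.mul_apply, Fin.sum_univ_four]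

/-- The six-pair sum over `μ < ν` in `Fin 4`, written out. -/
theorem sum_pairs_lt (f : Fin 4 → Fin 4 → ℂ) :
    (∑ μ : Fin 4, ∑ ν : Fin 4, if μ < ν then f μ ν else 0) =
      f 0 1 + f 0 2 + f 0 3 + f 1 2 + f 1 3 + f 2 3 := by
  simp only [Fin.sum_univ_four, Fin.isValue]
  norm_num [Fin.lt_def]
  ring

/-! ## The Clifford-contracted curvature in chirality blocks -/

/-- Row `0` of `𝔉v = Σ_{μ<ν} (γ_μγ_ν) ⊗ F_μν v` (upper chirality block). -/
theorem cliffordCurvature_apply_zero (F : Fin 4 → Fin 4 → Matrix (Fin 3) (Fin 3) ℂ)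
    (v : Fin 4 → Fin 3 → ℂ) (c : Fin 3) :
    (∑ μ : Fin 4, ∑ ν : Fin 4, if μ < ν then
      ∑ s' : Fin 4, (euclideanGamma μ * euclideanGamma ν) 0 s' * ∑ c' : Fin 3, F μ ν c c' * v s' c' else 0)
    = I * ((F 0 1 - F 2 3) *ᵥ v 0) c - ((F 0 2 + F 1 3) *ᵥ v 1) c - I * ((F 0 3 - F 1 2) *ᵥ v 1) c := by
  rw [sum_pairs_lt]
  simp only [Matrix.sub_mulVec, Matrix.add_mulVec, Pi.add_apply, Pi.sub_apply]
  simp only [Fin.sum_univ_four, Fin.isValue,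
    euclideanGamma_zero_mul_one, euclideanGamma_zero_mul_two, euclideanGamma_zero_mul_three,
    euclideanGamma_one_mul_two, euclideanGamma_one_mul_three, euclideanGamma_two_mul_three,
    Matrix.of_apply, Matrix.cons_val', Matrix.cons_val_zero, Matrix.cons_val_one, Matrix.cons_val,
    Matrix.empty_val', Matrix.cons_val_fin_one, Matrix.mulVec, dotProduct]
  ring

/-- Row `1` of `𝔉v` (upper chirality block). -/
theorem cliffordCurvature_apply_one (F : Fin 4 → Fin 4 → Matrix (Fin 3) (Fin 3) ℂ)
    (v : Fin 4 → Fin 3 → ℂ) (c : Fin 3) :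
    (∑ μ : Fin 4, ∑ ν : Fin 4, if μ < ν then
      ∑ s' : Fin 4, (euclideanGamma μ * euclideanGamma ν) 1 s' * ∑ c' : Fin 3, F μ ν c c' * v s' c' else 0)
    = -(I * ((F 0 1 - F 2 3) *ᵥ v 1) c) + ((F 0 2 + F 1 3) *ᵥ v 0) c - I * ((F 0 3 - F 1 2) *ᵥ v 0) c := by
  rw [sum_pairs_lt]
  simp only [Matrix.sub_mulVec, Matrix.add_mulVec, Pi.add_apply, Pi.sub_apply]
  simp only [Fin.sum_univ_four, Fin.isValue,
    euclideanGamma_zero_mul_one, euclideanGamma_zero_mul_two, euclideanGamma_zero_mul_three,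
    euclideanGamma_one_mul_two, euclideanGamma_one_mul_three, euclideanGamma_two_mul_three,
    Matrix.of_apply, Matrix.cons_val', Matrix.cons_val_zero, Matrix.cons_val_one, Matrix.cons_val,
    Matrix.empty_val', Matrix.cons_val_fin_one, Matrix.mulVec, dotProduct]
  ring

/-- Row `2` of `𝔉v` (lower chirality block). -/
theorem cliffordCurvature_apply_two (F : Fin 4 → Fin 4 → Matrix (Fin 3) (Fin 3) ℂ)
    (v : Fin 4 → Fin 3 → ℂ) (c : Fin 3) :
    (∑ μ : Fin 4, ∑ ν : Fin 4, if μ < ν then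
      ∑ s' : Fin 4, (euclideanGamma μ * euclideanGamma ν) 2 s' * ∑ c' : Fin 3, F μ ν c c' * v s' c' else 0)
    = I * ((F 0 1 + F 2 3) *ᵥ v 2) c - ((F 0 2 - F 1 3) *ᵥ v 3) c + I * ((F 0 3 + F 1 2) *ᵥ v 3) c := by
  rw [sum_pairs_lt]
  simp only [Matrix.sub_mulVec, Matrix.add_mulVec, Pi.add_apply, Pi.sub_apply]
  simp only [Fin.sum_univ_four, Fin.isValue,
    euclideanGamma_zero_mul_one, euclideanGamma_zero_mul_two, euclideanGamma_zero_mul_three,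
    euclideanGamma_one_mul_two, euclideanGamma_one_mul_three, euclideanGamma_two_mul_three,
    Matrix.of_apply, Matrix.cons_val', Matrix.cons_val_zero, Matrix.cons_val_one, Matrix.cons_val,
    Matrix.empty_val', Matrix.cons_val_fin_one, Matrix.mulVec, dotProduct]
  ring

/-- Row `3` of `𝔉v` (lower chirality block). -/
theorem cliffordCurvature_apply_three (F : Fin 4 → Fin 4 → Matrix (Fin 3) (Fin 3) ℂ)
    (v : Fin 4 → Fin 3 → ℂ) (c : Fin 3) :
    (∑ μ : Fin 4, ∑ ν : Fin 4, if μ < ν then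
      ∑ s' : Fin 4, (euclideanGamma μ * euclideanGamma ν) 3 s' * ∑ c' : Fin 3, F μ ν c c' * v s' c' else 0)
    = -(I * ((F 0 1 + F 2 3) *ᵥ v 3) c) + ((F 0 2 - F 1 3) *ᵥ v 2) c + I * ((F 0 3 + F 1 2) *ᵥ v 2) c := by
  rw [sum_pairs_lt]
  simp only [Matrix.sub_mulVec, Matrix.add_mulVec, Pi.add_apply, Pi.sub_apply]
  simp only [Fin.sum_univ_four, Fin.isValue,
    euclideanGamma_zero_mul_one, euclideanGamma_zero_mul_two, euclideanGamma_zero_mul_three,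
    euclideanGamma_one_mul_two, euclideanGamma_one_mul_three, euclideanGamma_two_mul_three,
    Matrix.of_apply, Matrix.cons_val', Matrix.cons_val_zero, Matrix.cons_val_one, Matrix.cons_val,
    Matrix.empty_val', Matrix.cons_val_fin_one, Matrix.mulVec, dotProduct]
  ring

/-! ## Norm bounds -/

/-- The Frobenius norm of a complex matrix as the square root of the sum of squared entry norms. -/
theorem frobenius_norm_eq_sqrt {m n : Type*} [Fintype m] [Fintype n] (H : Matrix m n ℂ) :
    ‖H‖ = Real.sqrt (∑ i, ∑ j, ‖H i j‖ ^ 2) := by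
  rw [Matrix.frobenius_norm_def, Real.sqrt_eq_rpow]
  congr 1
  refine Finset.sum_congr rfl fun i _ => Finset.sum_congr rfl fun j _ => ?_
  exact Real.rpow_two _

/-- `‖H *ᵥ b‖` entrywise Cauchy–Schwarz: `‖(H b)_c‖ ≤ √(Σ_{c'} ‖H c c'‖²) · ‖b‖₂`. -/
theorem norm_mulVec_apply_le {m n : Type*} [Fintype m] [Fintype n] (H : Matrix m n ℂ) (b : n → ℂ) (c : m) :
    ‖(H *ᵥ b) c‖ ≤ Real.sqrt (∑ c', ‖H c c'‖ ^ 2) * Real.sqrt (∑ c', ‖b c'‖ ^ 2) := by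
  calc ‖(H *ᵥ b) c‖ = ‖∑ c', H c c' * b c'‖ := rfl
    _ ≤ ∑ c', ‖H c c' * b c'‖ := norm_sum_le _ _
    _ = ∑ c', ‖H c c'‖ * ‖b c'‖ := Finset.sum_congr rfl fun c' _ => norm_mul _ _
    _ ≤ _ := by
        -- Cauchy–Schwarz with square roots (folklore; cf. `sum_mul_le_sqrt_mul_sqrt` in the tree)
        rw [← Real.sqrt_mul (Finset.sum_nonneg fun i _ => sq_nonneg _)]
        exact (le_abs_self _).trans (Real.abs_le_sqrt (Finset.sum_mul_sq_le_sq_mul_sq _ _ _))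

/-- The sesquilinear Frobenius bound `|Σ_c conj(a_c) (H b)_c| ≤ ‖H‖_F ‖a‖₂ ‖b‖₂`. -/
theorem norm_sum_conj_mul_mulVec_le {m n : Type*} [Fintype m] [Fintype n] (H : Matrix m n ℂ)
    (a : m → ℂ) (b : n → ℂ) :
    ‖∑ c, starRingEnd ℂ (a c) * (H *ᵥ b) c‖ ≤
      ‖H‖ * Real.sqrt (∑ c, ‖a c‖ ^ 2) * Real.sqrt (∑ c', ‖b c'‖ ^ 2) := by
  have hb : 0 ≤ Real.sqrt (∑ c', ‖b c'‖ ^ 2) := Real.sqrt_nonneg _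
  calc ‖∑ c, starRingEnd ℂ (a c) * (H *ᵥ b) c‖
      ≤ ∑ c, ‖starRingEnd ℂ (a c) * (H *ᵥ b) c‖ := norm_sum_le _ _
    _ = ∑ c, ‖a c‖ * ‖(H *ᵥ b) c‖ := Finset.sum_congr rfl fun c _ => by
        rw [norm_mul, RCLike.norm_conj]
    _ ≤ ∑ c, ‖a c‖ * (Real.sqrt (∑ c', ‖H c c'‖ ^ 2) * Real.sqrt (∑ c', ‖b c'‖ ^ 2)) :=
        Finset.sum_le_sum fun c _ => mul_le_mul_of_nonneg_left (norm_mulVec_apply_le H b c) (norm_nonneg _)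
    _ = (∑ c, ‖a c‖ * Real.sqrt (∑ c', ‖H c c'‖ ^ 2)) * Real.sqrt (∑ c', ‖b c'‖ ^ 2) := by
        rw [Finset.sum_mul]
        exact Finset.sum_congr rfl fun c _ => by ring
    _ ≤ (Real.sqrt (∑ c, ‖a c‖ ^ 2) * Real.sqrt (∑ c, Real.sqrt (∑ c', ‖H c c'‖ ^ 2) ^ 2)) *
          Real.sqrt (∑ c', ‖b c'‖ ^ 2) :=
        mul_le_mul_of_nonneg_right (by
          rw [← Real.sqrt_mul (Finset.sum_nonneg fun i _ => sq_nonneg _)]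
          exact (le_abs_self _).trans (Real.abs_le_sqrt (Finset.sum_mul_sq_le_sq_mul_sq _ _ _))) hb
    _ = ‖H‖ * Real.sqrt (∑ c, ‖a c‖ ^ 2) * Real.sqrt (∑ c', ‖b c'‖ ^ 2) := by
        rw [frobenius_norm_eq_sqrt]
        congr 1
        rw [mul_comm]
        congr 2
        exact Finset.sum_congr rfl fun c _ =>
          Real.sq_sqrt (Finset.sum_nonneg fun _ _ => sq_nonneg _)

/-- The same bound with an extra unit phase `I`. -/
theorem norm_sum_conj_mul_I_mul_mulVec_le {m n : Type*} [Fintype m] [Fintype n] (H : Matrix m n ℂ)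
    (a : m → ℂ) (b : n → ℂ) :
    ‖∑ c, starRingEnd ℂ (a c) * (I * (H *ᵥ b) c)‖ ≤
      ‖H‖ * Real.sqrt (∑ c, ‖a c‖ ^ 2) * Real.sqrt (∑ c', ‖b c'‖ ^ 2) := by
  have h : ∑ c, starRingEnd ℂ (a c) * (I * (H *ᵥ b) c) = I * ∑ c, starRingEnd ℂ (a c) * (H *ᵥ b) c := by
    rw [Finset.mul_sum]
    exact Finset.sum_congr rfl fun c _ => by ring
  rw [h, norm_mul, Complex.norm_I, one_mul]
  exact norm_sum_conj_mul_mulVec_le H a b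

/-! ## The pointwise bound on `Re⟨v, 𝔉v⟩` -/

/-- **Chirality–Clifford bound.**  For every family of `3 × 3` complex matrices `F_μν` and every
`v ∈ ℂ⁴ ⊗ ℂ³`: `Re⟨v, Σ_{μ<ν} (γ_μγ_ν ⊗ F_μν) v⟩ ≤ √3·√(‖F₀₁−F₂₃‖² + ‖F₀₂+F₁₃‖² + ‖F₀₃−F₁₂‖²)·|v₊|² +
√3·√(‖F₀₁+F₂₃‖² + ‖F₀₂−F₁₃‖² + ‖F₀₃+F₁₂‖²)·|v₋|²` (Frobenius norms; `v₊` = spinor components `0,1`,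
`v₋` = components `2,3`).  On each chirality block only one duality half of `F` acts. -/
theorem re_inner_cliffordCurvature_le (F : Fin 4 → Fin 4 → Matrix (Fin 3) (Fin 3) ℂ)
    (v : Fin 4 → Fin 3 → ℂ) :
    (∑ s, ∑ c, starRingEnd ℂ (v s c) * (∑ μ : Fin 4, ∑ ν : Fin 4, if μ < ν then
      ∑ s' : Fin 4, (euclideanGamma μ * euclideanGamma ν) s s' * ∑ c' : Fin 3, F μ ν c c' * v s' c' else 0)).re
    ≤ Real.sqrt 3 * Real.sqrt (‖F 0 1 - F 2 3‖ ^ 2 + ‖F 0 2 + F 1 3‖ ^ 2 + ‖F 0 3 - F 1 2‖ ^ 2) *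
          (∑ c, (‖v 0 c‖ ^ 2 + ‖v 1 c‖ ^ 2)) +
      Real.sqrt 3 * Real.sqrt (‖F 0 1 + F 2 3‖ ^ 2 + ‖F 0 2 - F 1 3‖ ^ 2 + ‖F 0 3 + F 1 2‖ ^ 2) *
          (∑ c, (‖v 2 c‖ ^ 2 + ‖v 3 c‖ ^ 2)) := by
  -- `a + b + c ≤ √3 · √(a² + b² + c²)` (folklore; cf. `add_three_le_sqrt` elsewhere in the tree)
  have h3 : ∀ a b c : ℝ, a + b + c ≤ Real.sqrt 3 * Real.sqrt (a ^ 2 + b ^ 2 + c ^ 2) := fun a b c => by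
    rw [← Real.sqrt_mul (by norm_num : (0:ℝ) ≤ 3)]
    refine (le_abs_self _).trans (Real.abs_le_sqrt ?_)
    calc (a + b + c) ^ 2 ≤ (a + b + c) ^ 2 + ((a - b) ^ 2 + (a - c) ^ 2 + (b - c) ^ 2) :=
          le_add_of_nonneg_right (by positivity)
      _ = 3 * (a ^ 2 + b ^ 2 + c ^ 2) := by ring
  rw [Fin.sum_univ_four]
  simp only [cliffordCurvature_apply_zero, cliffordCurvature_apply_one,
    cliffordCurvature_apply_two, cliffordCurvature_apply_three]
  -- names
  set M₁ := F 0 1 - F 2 3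
  set M₂ := F 0 2 + F 1 3
  set M₃ := F 0 3 - F 1 2
  set P₁ := F 0 1 + F 2 3
  set P₂ := F 0 2 - F 1 3
  set P₃ := F 0 3 + F 1 2
  set n : Fin 4 → ℝ := fun s => Real.sqrt (∑ c, ‖v s c‖ ^ 2) with hn
  have hn0 : ∀ s, 0 ≤ n s := fun s => Real.sqrt_nonneg _
  have hn2 : ∀ s, n s ^ 2 = ∑ c, ‖v s c‖ ^ 2 := fun s =>
    Real.sq_sqrt (Finset.sum_nonneg fun _ _ => sq_nonneg _)
  -- the four blocks, distributed
  have e0 : ∑ c, starRingEnd ℂ (v 0 c) * (I * (M₁ *ᵥ v 0) c - (M₂ *ᵥ v 1) c - I * (M₃ *ᵥ v 1) c)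
      = ∑ c, starRingEnd ℂ (v 0 c) * (I * (M₁ *ᵥ v 0) c) - ∑ c, starRingEnd ℂ (v 0 c) * (M₂ *ᵥ v 1) c
        - ∑ c, starRingEnd ℂ (v 0 c) * (I * (M₃ *ᵥ v 1) c) := by
    rw [← Finset.sum_sub_distrib, ← Finset.sum_sub_distrib]
    exact Finset.sum_congr rfl fun c _ => by ring
  have e1 : ∑ c, starRingEnd ℂ (v 1 c) * (-(I * (M₁ *ᵥ v 1) c) + (M₂ *ᵥ v 0) c - I * (M₃ *ᵥ v 0) c)
      = -(∑ c, starRingEnd ℂ (v 1 c) * (I * (M₁ *ᵥ v 1) c)) + ∑ c, starRingEnd ℂ (v 1 c) * (M₂ *ᵥ v 0) c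
        - ∑ c, starRingEnd ℂ (v 1 c) * (I * (M₃ *ᵥ v 0) c) := by
    rw [← Finset.sum_neg_distrib, ← Finset.sum_add_distrib, ← Finset.sum_sub_distrib]
    exact Finset.sum_congr rfl fun c _ => by ring
  have e2 : ∑ c, starRingEnd ℂ (v 2 c) * (I * (P₁ *ᵥ v 2) c - (P₂ *ᵥ v 3) c + I * (P₃ *ᵥ v 3) c)
      = ∑ c, starRingEnd ℂ (v 2 c) * (I * (P₁ *ᵥ v 2) c) - ∑ c, starRingEnd ℂ (v 2 c) * (P₂ *ᵥ v 3) c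
        + ∑ c, starRingEnd ℂ (v 2 c) * (I * (P₃ *ᵥ v 3) c) := by
    rw [← Finset.sum_sub_distrib, ← Finset.sum_add_distrib]
    exact Finset.sum_congr rfl fun c _ => by ring
  have e3 : ∑ c, starRingEnd ℂ (v 3 c) * (-(I * (P₁ *ᵥ v 3) c) + (P₂ *ᵥ v 2) c + I * (P₃ *ᵥ v 2) c)
      = -(∑ c, starRingEnd ℂ (v 3 c) * (I * (P₁ *ᵥ v 3) c)) + ∑ c, starRingEnd ℂ (v 3 c) * (P₂ *ᵥ v 2) c
        + ∑ c, starRingEnd ℂ (v 3 c) * (I * (P₃ *ᵥ v 2) c) := by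
    rw [← Finset.sum_neg_distrib, ← Finset.sum_add_distrib, ← Finset.sum_add_distrib]
    exact Finset.sum_congr rfl fun c _ => by ring
  rw [e0, e1, e2, e3]
  -- bound each of the twelve terms
  have b01 : ‖∑ c, starRingEnd ℂ (v 0 c) * (I * (M₁ *ᵥ v 0) c)‖ ≤ ‖M₁‖ * n 0 * n 0 :=
    norm_sum_conj_mul_I_mul_mulVec_le M₁ (v 0) (v 0)
  have b02 : ‖∑ c, starRingEnd ℂ (v 0 c) * (M₂ *ᵥ v 1) c‖ ≤ ‖M₂‖ * n 0 * n 1 :=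
    norm_sum_conj_mul_mulVec_le M₂ (v 0) (v 1)
  have b03 : ‖∑ c, starRingEnd ℂ (v 0 c) * (I * (M₃ *ᵥ v 1) c)‖ ≤ ‖M₃‖ * n 0 * n 1 :=
    norm_sum_conj_mul_I_mul_mulVec_le M₃ (v 0) (v 1)
  have b11 : ‖∑ c, starRingEnd ℂ (v 1 c) * (I * (M₁ *ᵥ v 1) c)‖ ≤ ‖M₁‖ * n 1 * n 1 :=
    norm_sum_conj_mul_I_mul_mulVec_le M₁ (v 1) (v 1)
  have b12 : ‖∑ c, starRingEnd ℂ (v 1 c) * (M₂ *ᵥ v 0) c‖ ≤ ‖M₂‖ * n 1 * n 0 :=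
    norm_sum_conj_mul_mulVec_le M₂ (v 1) (v 0)
  have b13 : ‖∑ c, starRingEnd ℂ (v 1 c) * (I * (M₃ *ᵥ v 0) c)‖ ≤ ‖M₃‖ * n 1 * n 0 :=
    norm_sum_conj_mul_I_mul_mulVec_le M₃ (v 1) (v 0)
  have b21 : ‖∑ c, starRingEnd ℂ (v 2 c) * (I * (P₁ *ᵥ v 2) c)‖ ≤ ‖P₁‖ * n 2 * n 2 :=
    norm_sum_conj_mul_I_mul_mulVec_le P₁ (v 2) (v 2)
  have b22 : ‖∑ c, starRingEnd ℂ (v 2 c) * (P₂ *ᵥ v 3) c‖ ≤ ‖P₂‖ * n 2 * n 3 :=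
    norm_sum_conj_mul_mulVec_le P₂ (v 2) (v 3)
  have b23 : ‖∑ c, starRingEnd ℂ (v 2 c) * (I * (P₃ *ᵥ v 3) c)‖ ≤ ‖P₃‖ * n 2 * n 3 :=
    norm_sum_conj_mul_I_mul_mulVec_le P₃ (v 2) (v 3)
  have b31 : ‖∑ c, starRingEnd ℂ (v 3 c) * (I * (P₁ *ᵥ v 3) c)‖ ≤ ‖P₁‖ * n 3 * n 3 :=
    norm_sum_conj_mul_I_mul_mulVec_le P₁ (v 3) (v 3)
  have b32 : ‖∑ c, starRingEnd ℂ (v 3 c) * (P₂ *ᵥ v 2) c‖ ≤ ‖P₂‖ * n 3 * n 2 :=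
    norm_sum_conj_mul_mulVec_le P₂ (v 3) (v 2)
  have b33 : ‖∑ c, starRingEnd ℂ (v 3 c) * (I * (P₃ *ᵥ v 2) c)‖ ≤ ‖P₃‖ * n 3 * n 2 :=
    norm_sum_conj_mul_I_mul_mulVec_le P₃ (v 3) (v 2)
  clear e0 e1 e2 e3
  clear_value n
  generalize ∑ c, starRingEnd ℂ (v 0 c) * (I * (M₁ *ᵥ v 0) c) = T01 at b01 ⊢
  generalize ∑ c, starRingEnd ℂ (v 0 c) * (M₂ *ᵥ v 1) c = T02 at b02 ⊢
  generalize ∑ c, starRingEnd ℂ (v 0 c) * (I * (M₃ *ᵥ v 1) c) = T03 at b03 ⊢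
  generalize ∑ c, starRingEnd ℂ (v 1 c) * (I * (M₁ *ᵥ v 1) c) = T11 at b11 ⊢
  generalize ∑ c, starRingEnd ℂ (v 1 c) * (M₂ *ᵥ v 0) c = T12 at b12 ⊢
  generalize ∑ c, starRingEnd ℂ (v 1 c) * (I * (M₃ *ᵥ v 0) c) = T13 at b13 ⊢
  generalize ∑ c, starRingEnd ℂ (v 2 c) * (I * (P₁ *ᵥ v 2) c) = T21 at b21 ⊢
  generalize ∑ c, starRingEnd ℂ (v 2 c) * (P₂ *ᵥ v 3) c = T22 at b22 ⊢
  generalize ∑ c, starRingEnd ℂ (v 2 c) * (I * (P₃ *ᵥ v 3) c) = T23 at b23 ⊢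
  generalize ∑ c, starRingEnd ℂ (v 3 c) * (I * (P₁ *ᵥ v 3) c) = T31 at b31 ⊢
  generalize ∑ c, starRingEnd ℂ (v 3 c) * (P₂ *ᵥ v 2) c = T32 at b32 ⊢
  generalize ∑ c, starRingEnd ℂ (v 3 c) * (I * (P₃ *ᵥ v 2) c) = T33 at b33 ⊢
  have hN₁ := norm_nonneg M₁
  have hN₂ := norm_nonneg M₂
  have hN₃ := norm_nonneg M₃
  have hP₁ := norm_nonneg P₁
  have hP₂ := norm_nonneg P₂
  have hP₃ := norm_nonneg P₃
  generalize ‖M₁‖ = N₁ at *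
  generalize ‖M₂‖ = N₂ at *
  generalize ‖M₃‖ = N₃ at *
  generalize ‖P₁‖ = Q₁ at *
  generalize ‖P₂‖ = Q₂ at *
  generalize ‖P₃‖ = Q₃ at *
  have hre : ∀ z : ℂ, |z.re| ≤ ‖z‖ := fun z => Complex.abs_re_le_norm z
  have a01 := abs_le.mp ((hre _).trans b01)
  have a02 := abs_le.mp ((hre _).trans b02)
  have a03 := abs_le.mp ((hre _).trans b03)
  have a11 := abs_le.mp ((hre _).trans b11)
  have a12 := abs_le.mp ((hre _).trans b12)
  have a13 := abs_le.mp ((hre _).trans b13)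
  have a21 := abs_le.mp ((hre _).trans b21)
  have a22 := abs_le.mp ((hre _).trans b22)
  have a23 := abs_le.mp ((hre _).trans b23)
  have a31 := abs_le.mp ((hre _).trans b31)
  have a32 := abs_le.mp ((hre _).trans b32)
  have a33 := abs_le.mp ((hre _).trans b33)
  simp only [Complex.add_re, Complex.sub_re, Complex.neg_re]
  -- collect
  have step1 :
      T01.re - T02.re - T03.re + (-T11.re + T12.re - T13.re) + (T21.re - T22.re + T23.re)
        + (-T31.re + T32.re + T33.re)
      ≤ N₁ * n 0 * n 0 + N₂ * n 0 * n 1 + N₃ * n 0 * n 1 + (N₁ * n 1 * n 1 + N₂ * n 1 * n 0 + N₃ * n 1 * n 0)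
        + (Q₁ * n 2 * n 2 + Q₂ * n 2 * n 3 + Q₃ * n 2 * n 3) + (Q₁ * n 3 * n 3 + Q₂ * n 3 * n 2 + Q₃ * n 3 * n 2) := by
    linarith only [a01.2, a02.1, a03.1, a11.1, a12.2, a13.1, a21.2, a22.1, a23.2, a31.1, a32.2, a33.2]
  have hM23 : 0 ≤ N₂ + N₃ := add_nonneg hN₂ hN₃
  have hQ23 : 0 ≤ Q₂ + Q₃ := add_nonneg hP₂ hP₃
  have h01 : 2 * (n 0 * n 1) ≤ n 0 * n 0 + n 1 * n 1 := by nlinarith only [sq_nonneg (n 0 - n 1)]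
  have h23 : 2 * (n 2 * n 3) ≤ n 2 * n 2 + n 3 * n 3 := by nlinarith only [sq_nonneg (n 2 - n 3)]
  have k1 := mul_le_mul_of_nonneg_left h01 hM23
  have k2 := mul_le_mul_of_nonneg_left h23 hQ23
  have hq01 : 0 ≤ n 0 * n 0 + n 1 * n 1 := add_nonneg (mul_nonneg (hn0 0) (hn0 0)) (mul_nonneg (hn0 1) (hn0 1))
  have hq23 : 0 ≤ n 2 * n 2 + n 3 * n 3 := add_nonneg (mul_nonneg (hn0 2) (hn0 2)) (mul_nonneg (hn0 3) (hn0 3))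
  have step3 := mul_le_mul_of_nonneg_right (h3 N₁ N₂ N₃) hq01
  have step4 := mul_le_mul_of_nonneg_right (h3 Q₁ Q₂ Q₃) hq23
  have hsum01 : n 0 * n 0 + n 1 * n 1 = ∑ c, (‖v 0 c‖ ^ 2 + ‖v 1 c‖ ^ 2) := by
    rw [Finset.sum_add_distrib, ← hn2 0, ← hn2 1]; ring
  have hsum23 : n 2 * n 2 + n 3 * n 3 = ∑ c, (‖v 2 c‖ ^ 2 + ‖v 3 c‖ ^ 2) := by
    rw [Finset.sum_add_distrib, ← hn2 2, ← hn2 3]; ring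
  rw [← hsum01, ← hsum23]
  generalize Real.sqrt 3 * Real.sqrt (N₁ ^ 2 + N₂ ^ 2 + N₃ ^ 2) = R₁ at step3 ⊢
  generalize Real.sqrt 3 * Real.sqrt (Q₁ ^ 2 + Q₂ ^ 2 + Q₃ ^ 2) = R₂ at step4 ⊢
  have step2 :
      N₁ * n 0 * n 0 + N₂ * n 0 * n 1 + N₃ * n 0 * n 1 + (N₁ * n 1 * n 1 + N₂ * n 1 * n 0 + N₃ * n 1 * n 0)
        + (Q₁ * n 2 * n 2 + Q₂ * n 2 * n 3 + Q₃ * n 2 * n 3) + (Q₁ * n 3 * n 3 + Q₂ * n 3 * n 2 + Q₃ * n 3 * n 2)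
      ≤ (N₁ + N₂ + N₃) * (n 0 * n 0 + n 1 * n 1) + (Q₁ + Q₂ + Q₃) * (n 2 * n 2 + n 3 * n 3) := by
    ring_nf
    ring_nf at k1 k2
    linarith only [k1, k2]
  have step5 : (N₁ + N₂ + N₃) * (n 0 * n 0 + n 1 * n 1) + (Q₁ + Q₂ + Q₃) * (n 2 * n 2 + n 3 * n 3)
      ≤ R₁ * (n 0 * n 0 + n 1 * n 1) + R₂ * (n 2 * n 2 + n 3 * n 3) := add_le_add step3 step4
  linarith only [step1, step2, step5]

end Summit.QuantumFields.QCD.Cruxes.EarlyCrosserLaw.ZeroModeFloorDiluteGas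

end
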